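import Mathlib
import HarnessLib
import Summits.NavierStokesRegularity.NavierStokesRegularity.Theorems.PoloidalWindowDoorPoloidalWindowRigidityFluxTransport

/-!
# Route `PoloidalWindowDoor`, crux `PoloidalWindowRigidity` (stmt-NavierStokesRegularity-19708) — LINE 16 «zero_mode» (ns-idea-8 g8, v1.1), stub Z-oseen
# `stub_zeroModeOseen`, GEOMETRY STEP: coordinate boxes `{|x 0| ≤ R₀ ∧ |x 1| ≤ R₀ ∧ lo ≤ x 2 ∧ x 2 ≤ hi}` — measurability, volume `4R₀²(hi−lo)`,
# `r`-separation of a shrunken box from the complement, and the shell volume `|Q_{R,H} ∖ Q_core| ≤ 16 r R (R+H)`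

Cell ns-regularity-ideate, seat ns-poloidal-K2-p2 g13 (K2 hand).  Helper file (no stub closed here) for the L-sized stub Z-oseen of LINE 16: the three
boxes of the three-region estimate (`…ZeroModeBoxKernel.lintegral_enorm_setIntegral_oseenKernel_le`) are `Q = Q_{R,H}` (`R₀ = R`, `[lo,hi] = [0,H]`, the
flat box of the line with `flatBox` unfolded as in `…FluxTransport`), `Q_in` (`R − r`, `[r, H − r]`) and `Q_core` (`R − 2r`, `[2r, H − 2r]`); a point of a box
shrunken by `ρ` is at distance `≥ ρ` from every point outside the box (one coordinate differs by `≥ ρ`, `|z i| ≤ ‖z‖`).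

WHAT THIS IS NOT: Z-oseen itself; 19708 / 20428 / ⟨27893⟩ OPEN; no claim about Navier–Stokes regularity.
-/

noncomputable section

-- the summit and its single sub-problem share the name (CONVENTIONS §1), as in every Theorems file
set_option linter.dupNamespace false

namespace Summit.NavierStokesRegularity.NavierStokesRegularity.Theorems.PoloidalWindowDoorPoloidalWindowRigidityZeroModeBoxes

open MeasureTheory Set Function Filter Topology
open scoped RealInnerProductSpace ENNReal
open Summit.NavierStokesRegularity.NavierStokesRegularity.Theorems.PoloidalWindowDoorPoloidalWindowRigidityFluxTransport

/-! ## Coordinate boxes -/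

/-- The box `{|x 0| ≤ R₀ ∧ |x 1| ≤ R₀ ∧ lo ≤ x 2 ∧ x 2 ≤ hi}` is the preimage under `ofLp` of `[(−R₀,−R₀,lo), (R₀,R₀,hi)] ⊂ Fin 3 → ℝ`. [folklore] -/
theorem box_eq_preimage (R₀ lo hi : ℝ) :
    {x : EuclideanSpace ℝ (Fin 3) | |x 0| ≤ R₀ ∧ |x 1| ≤ R₀ ∧ lo ≤ x 2 ∧ x 2 ≤ hi} =
      (WithLp.ofLp : EuclideanSpace ℝ (Fin 3) → (Fin 3 → ℝ)) ⁻¹' Icc (![-R₀, -R₀, lo] : Fin 3 → ℝ) ![R₀, R₀, hi] := by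
  ext x
  simp only [mem_setOf_eq, mem_preimage, mem_Icc, Pi.le_def]
  constructor
  · rintro ⟨h0, h1, h2, h3⟩
    obtain ⟨h0a, h0b⟩ := abs_le.1 h0
    obtain ⟨h1a, h1b⟩ := abs_le.1 h1
    refine ⟨fun i => ?_, fun i => ?_⟩ <;> fin_cases i <;> simp <;> assumption
  · rintro ⟨hlo, hhi⟩
    have h0a := hlo 0; have h0b := hhi 0; have h1a := hlo 1; have h1b := hhi 1; have h2a := hlo 2; have h2b := hhi 2
    simp at h0a h0b h1a h1b h2a h2b
    exact ⟨abs_le.2 ⟨h0a, h0b⟩, abs_le.2 ⟨h1a, h1b⟩, h2a, h2b⟩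

/-- Coordinate boxes are measurable. [folklore] -/
theorem measurableSet_box (R₀ lo hi : ℝ) :
    MeasurableSet {x : EuclideanSpace ℝ (Fin 3) | |x 0| ≤ R₀ ∧ |x 1| ≤ R₀ ∧ lo ≤ x 2 ∧ x 2 ≤ hi} := by
  rw [box_eq_preimage]
  exact measurableSet_Icc.preimage measurableEmbedding_ofLp.measurable

/-- **Volume of a coordinate box**: `4R₀²(hi − lo)` for `R₀ ≥ 0` (both sides vanish when `hi < lo`). [folklore] -/
theorem volume_box {R₀ : ℝ} (lo hi : ℝ) (hR₀ : 0 ≤ R₀) :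
    volume {x : EuclideanSpace ℝ (Fin 3) | |x 0| ≤ R₀ ∧ |x 1| ≤ R₀ ∧ lo ≤ x 2 ∧ x 2 ≤ hi} =
      ENNReal.ofReal (4 * R₀ ^ 2 * (hi - lo)) := by
  rw [box_eq_preimage, (PiLp.volume_preserving_ofLp (Fin 3)).measure_preimage_emb measurableEmbedding_ofLp,
    Real.volume_Icc_pi, Fin.prod_univ_three]
  simp only [Matrix.cons_val_zero, Matrix.cons_val_one, Matrix.cons_val_two, Matrix.head_cons, Matrix.tail_cons, sub_neg_eq_add]
  rw [← ENNReal.ofReal_mul (by linarith), ← ENNReal.ofReal_mul (by positivity)]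
  congr 1
  ring

/-- The volume of a coordinate box is at most `ofReal (4R₀²(hi − lo))` (degenerate boxes included). [folklore] -/
theorem volume_box_le (R₀ lo hi : ℝ) :
    volume {x : EuclideanSpace ℝ (Fin 3) | |x 0| ≤ R₀ ∧ |x 1| ≤ R₀ ∧ lo ≤ x 2 ∧ x 2 ≤ hi} ≤
      ENNReal.ofReal (4 * R₀ ^ 2 * (hi - lo)) := by
  by_cases hR₀ : 0 ≤ R₀
  · exact (volume_box lo hi hR₀).le
  · have hempty : {x : EuclideanSpace ℝ (Fin 3) | |x 0| ≤ R₀ ∧ |x 1| ≤ R₀ ∧ lo ≤ x 2 ∧ x 2 ≤ hi} = ∅ := by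
      ext x; simp only [mem_setOf_eq, mem_empty_iff_false, iff_false]; rintro ⟨h0, -, -, -⟩
      exact hR₀ ((abs_nonneg _).trans h0)
    rw [hempty, measure_empty]; exact bot_le

/-- A box shrunken by `ρ ≥ 0` lies inside the box. [folklore] -/
theorem box_shrink_subset {R₀ lo hi ρ : ℝ} (hρ : 0 ≤ ρ) :
    {x : EuclideanSpace ℝ (Fin 3) | |x 0| ≤ R₀ - ρ ∧ |x 1| ≤ R₀ - ρ ∧ lo + ρ ≤ x 2 ∧ x 2 ≤ hi - ρ} ⊆
      {x : EuclideanSpace ℝ (Fin 3) | |x 0| ≤ R₀ ∧ |x 1| ≤ R₀ ∧ lo ≤ x 2 ∧ x 2 ≤ hi} := by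
  rintro x ⟨h0, h1, h2, h3⟩
  exact ⟨by linarith, by linarith, by linarith, by linarith⟩

/-- **`ρ`-separation**: a point `y` of the box shrunken by `ρ` is at distance `≥ ρ` from every point `x` outside the box (one coordinate of `x − y`
has modulus `≥ ρ`, and `|z i| ≤ ‖z‖` on `E3`). [folklore] -/
theorem le_norm_sub_of_shrink {R₀ lo hi ρ : ℝ} {x y : EuclideanSpace ℝ (Fin 3)}
    (hy : y ∈ {x : EuclideanSpace ℝ (Fin 3) | |x 0| ≤ R₀ - ρ ∧ |x 1| ≤ R₀ - ρ ∧ lo + ρ ≤ x 2 ∧ x 2 ≤ hi - ρ})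
    (hx : x ∉ {x : EuclideanSpace ℝ (Fin 3) | |x 0| ≤ R₀ ∧ |x 1| ≤ R₀ ∧ lo ≤ x 2 ∧ x 2 ≤ hi}) :
    ρ ≤ ‖x - y‖ := by
  obtain ⟨hy0, hy1, hy2, hy3⟩ := hy
  have hcoord : ∀ i : Fin 3, |x i - y i| ≤ ‖x - y‖ := fun i => by
    have h := PiLp.norm_apply_le (x - y) i
    rwa [PiLp.sub_apply, Real.norm_eq_abs] at h
  simp only [mem_setOf_eq, not_and_or, not_le] at hx
  rcases hx with h | h | h | h
  · refine le_trans ?_ (hcoord 0)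
    have := abs_le.1 hy0
    rcases le_or_gt 0 (x 0) with hx0 | hx0
    · rw [abs_of_nonneg hx0] at h; rw [le_abs]; left; linarith [this.2]
    · rw [abs_of_neg hx0] at h; rw [le_abs]; right; linarith [this.1]
  · refine le_trans ?_ (hcoord 1)
    have := abs_le.1 hy1
    rcases le_or_gt 0 (x 1) with hx1 | hx1
    · rw [abs_of_nonneg hx1] at h; rw [le_abs]; left; linarith [this.2]
    · rw [abs_of_neg hx1] at h; rw [le_abs]; right; linarith [this.1]
  · refine le_trans ?_ (hcoord 2)
    rw [le_abs]; right; linarith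
  · refine le_trans ?_ (hcoord 2)
    rw [le_abs]; left; linarith

/-- **`ρ`-separation, outward form**: a point `x` of the box shrunken by `ρ` is at distance `≥ ρ` from every point `y` outside the box. [folklore] -/
theorem le_norm_sub_of_shrink' {R₀ lo hi ρ : ℝ} {x y : EuclideanSpace ℝ (Fin 3)}
    (hx : x ∈ {x : EuclideanSpace ℝ (Fin 3) | |x 0| ≤ R₀ - ρ ∧ |x 1| ≤ R₀ - ρ ∧ lo + ρ ≤ x 2 ∧ x 2 ≤ hi - ρ})
    (hy : y ∉ {x : EuclideanSpace ℝ (Fin 3) | |x 0| ≤ R₀ ∧ |x 1| ≤ R₀ ∧ lo ≤ x 2 ∧ x 2 ≤ hi}) :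
    ρ ≤ ‖x - y‖ := by
  rw [norm_sub_rev]; exact le_norm_sub_of_shrink hx hy

/-- **Shell volume**: for `0 ≤ r`, `2r ≤ R`, `4r ≤ H`, the flat box `Q_{R,H}` minus its core (`Q` shrunk twice by `r`: `R − r − r`, `[0 + r + r, H − r − r]`)
has volume `4R²H − 4(R−2r)²(H−4r) ≤ 16 r R (R + H)`. [folklore] -/
theorem volume_flatBox_diff_core_le {R H r : ℝ} (hr : 0 ≤ r) (hrR : 2 * r ≤ R) (hrH : 4 * r ≤ H) :
    volume ({x : EuclideanSpace ℝ (Fin 3) | |x 0| ≤ R ∧ |x 1| ≤ R ∧ 0 ≤ x 2 ∧ x 2 ≤ H} \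
        {x : EuclideanSpace ℝ (Fin 3) | |x 0| ≤ R - r - r ∧ |x 1| ≤ R - r - r ∧ 0 + r + r ≤ x 2 ∧ x 2 ≤ H - r - r}) ≤
      ENNReal.ofReal (16 * r * R * (R + H)) := by
  have hR : 0 ≤ R := by linarith
  have hsub : {x : EuclideanSpace ℝ (Fin 3) | |x 0| ≤ R - r - r ∧ |x 1| ≤ R - r - r ∧ 0 + r + r ≤ x 2 ∧ x 2 ≤ H - r - r} ⊆
      {x : EuclideanSpace ℝ (Fin 3) | |x 0| ≤ R ∧ |x 1| ≤ R ∧ 0 ≤ x 2 ∧ x 2 ≤ H} :=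
    (box_shrink_subset (R₀ := R - r) (lo := 0 + r) (hi := H - r) hr).trans (box_shrink_subset hr)
  have hcore : volume {x : EuclideanSpace ℝ (Fin 3) | |x 0| ≤ R - r - r ∧ |x 1| ≤ R - r - r ∧ 0 + r + r ≤ x 2 ∧ x 2 ≤ H - r - r} =
      ENNReal.ofReal (4 * (R - r - r) ^ 2 * (H - r - r - (0 + r + r))) := volume_box _ _ (by linarith)
  have hnn : 0 ≤ 4 * (R - r - r) ^ 2 * (H - r - r - (0 + r + r)) :=
    mul_nonneg (mul_nonneg (by norm_num) (sq_nonneg _)) (by linarith)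
  rw [measure_sdiff hsub (measurableSet_box _ _ _).nullMeasurableSet (by rw [hcore]; exact ENNReal.ofReal_ne_top),
    volume_box 0 H hR, hcore, ← ENNReal.ofReal_sub _ hnn]
  refine ENNReal.ofReal_le_ofReal ?_
  nlinarith [mul_nonneg hr hR, mul_nonneg hr (sub_nonneg.2 hrR), mul_nonneg (mul_nonneg hr hr) (sub_nonneg.2 hrR),
    mul_nonneg (mul_nonneg hr hr) (sub_nonneg.2 hrH), mul_nonneg hr (by linarith : 0 ≤ H)]

end Summit.NavierStokesRegularity.NavierStokesRegularity.Theorems.PoloidalWindowDoorPoloidalWindowRigidityZeroModeBoxes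

end
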